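import Summits.ResolutionOfSingularities.ResolutionOfSingularities.Theorems.CurveLeafExitClasses
import Summits.ResolutionOfSingularities.ResolutionOfSingularities.Theorems.RelativeDeltaCutKernels
import HarnessLib

/-!
# CurveLeafExitKernels — §K of the decomp-res node «CurveLeafExit» (lens-2 g13, sha256 cbe610aaf56bd15d; critic
row 90 CLEARED)

Tree file 2/3, route-independent: the pure-logic kernels among the classes — pointwise EXHAUSTION
`classGE_or_gen_or_lspecial`, projections of a leaf-special point, the EXACT cut `seqDimFour_one_iff : SeqDimFour 1 n ⟺
SeqLGen n ∧ SeqLSpec n`, comparison edges with g10/g11/g12 schemas, the isolation and strata sub-cuts, the ENGINES at a point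
and `relGenericRung`-type assemblies — VERBATIM (0 sorry); preceded by the lens's in-Lean bed-row arithmetic sanity examples.
(Sources: CossartJannsenSaito2020 Thm. 2.14, Ch. 8; CossartPiltant2008 Prop. 4.2; CossartPiltant2019 Rem. 3.2;
Moh1987; Giraud1975.)
-/

open CategoryTheory AlgebraicGeometry TopologicalSpace IsLocalRing
open Literature.AlgebraicGeometry.Resolution
open Summit.ResolutionOfSingularities.ResolutionOfSingularities.Theorems
open Summit.ResolutionOfSingularities.ResolutionOfSingularities.Theorems.WeakOrderReduction
open Summit.ResolutionOfSingularities.ResolutionOfSingularities.Theorems.DeltaFaceCutClasses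
open Summit.ResolutionOfSingularities.ResolutionOfSingularities.Theorems.RelativeDeltaCut

namespace Summit.ResolutionOfSingularities.ResolutionOfSingularities.Theorems.CurveLeafExit

/-! ### Arithmetic of the bed rows (the layered reading, in-Lean sanity; `θb = thetaNum`, `m = packageLength`) -/

example : thetaNum 3 2 = 1 ∧ packageLength 3 2 = 1 := by decide              -- KV59: δ = 3/2, one blow-up of C
example : ¬ (1 * 0 + 2 * (0 + 2) < 1 * 4) ∧ 1 * 0 + 2 * (0 + 2) ≤ 1 * 4 := by decide
  -- KV59 at the jump point: layer γ = 2, |β| = 0: (G1ʳ) fails, (G2ʳ) holds (n = 4 = 2²): near point, τ ≥ 2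
example : thetaNum 10 3 = 2 ∧ packageLength 10 3 = 3 := by decide            -- insep:3:xy10: δ = 10/3, three blow-ups
example : 2 * 0 + 3 * (0 + 1) < 2 * 3 := by decide                           -- (G1ʳ) with γ = 1: z₃³ + xy, order 2
example : thetaNum 26 5 = 4 ∧ packageLength 26 5 = 5 := by decide            -- insep:5:xy26: δ = 26/5, five blow-ups
example : 4 * 0 + 5 * (0 + 1) < 4 * 5 := by decide                           -- (G1ʳ) with γ = 1: z₅⁵ + xy, order 2


/-! ## §K  Kernels — pure logic (0 sorry)
[WRITER NOTE (decomp-res writer g5): the lens's pointwise edges `isPackageExitPt_of_isDeltaGenericPt`,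
`isNearExitPt_of_isNearGenericPt`, `isCurveExitPt_of_isCurveGenericPt` are the tree's `RelativeDeltaCut.*` (gate dedup) — used by
name through `open … RelativeDeltaCut`, not restated.] -/

section Kernels

variable {n : ℕ}

/-- Pointwise EXHAUSTION: a top point is of class ≥ 2, near-generic, δ-generic, curve-generic, rel-curve-generic or a
flat-curve point — or leaf-special. [folklore] -/
theorem classGE_or_gen_or_lspecial {k : Type} [Field k] {Y : Scheme.{0}} (g : Y ⟶ Spec (.of k))
    (hY : Scheme.IsRegular Y) (I : Y.IdealSheafData) (n : ℕ) (y : Y) :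
    (ClassGE g hY I n 2 y ∨ VeryNearCutClasses.IsNearGenericPt I n y ∨ IsDeltaGenericPt I n y ∨
        IsCurveGenericPt I n y ∨ IsRelCurveGenericPt I n y ∨ IsFlatCurvePt I n y) ∨
      IsLeafSpecialPt g hY I n y := by
  by_cases h1 : ClassGE g hY I n 2 y
  · exact Or.inl (Or.inl h1)
  by_cases h2 : VeryNearCutClasses.IsNearGenericPt I n y
  · exact Or.inl (Or.inr (Or.inl h2))
  by_cases h3 : IsDeltaGenericPt I n y
  · exact Or.inl (Or.inr (Or.inr (Or.inl h3)))
  by_cases h4 : IsCurveGenericPt I n y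
  · exact Or.inl (Or.inr (Or.inr (Or.inr (Or.inl h4))))
  by_cases h5 : IsRelCurveGenericPt I n y
  · exact Or.inl (Or.inr (Or.inr (Or.inr (Or.inr (Or.inl h5)))))
  by_cases h6 : IsFlatCurvePt I n y
  · exact Or.inl (Or.inr (Or.inr (Or.inr (Or.inr (Or.inr h6)))))
  · exact Or.inr ⟨⟨⟨h1, h2⟩, h3, h4⟩, h5, h6⟩

/-- A leaf-special point is in none of the six decided classes. [folklore] -/
theorem not_gen_of_isLeafSpecialPt {k : Type} [Field k] {Y : Scheme.{0}} {g : Y ⟶ Spec (.of k)}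
    {hY : Scheme.IsRegular Y} {I : Y.IdealSheafData} {n : ℕ} {y : Y} (h : IsLeafSpecialPt g hY I n y) :
    ¬ (ClassGE g hY I n 2 y ∨ VeryNearCutClasses.IsNearGenericPt I n y ∨ IsDeltaGenericPt I n y ∨
        IsCurveGenericPt I n y ∨ IsRelCurveGenericPt I n y ∨ IsFlatCurvePt I n y) := by
  rintro (hc | hg | hd | hu | hr | hf)
  · exact h.1.1.1 hc
  · exact h.1.1.2 hg
  · exact h.1.2.1 hd
  · exact h.1.2.2 hu
  · exact h.2.1 hr
  · exact h.2.2 hf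

/-- A leaf-special point is relatively special (g12, restated) — projection. [folklore] -/
theorem isRelSpecialPt_of_isLeafSpecialPt {k : Type} [Field k] {Y : Scheme.{0}} {g : Y ⟶ Spec (.of k)}
    {hY : Scheme.IsRegular Y} {I : Y.IdealSheafData} {n : ℕ} {y : Y} (h : IsLeafSpecialPt g hY I n y) :
    IsRelSpecialPt g hY I n y :=
  h.1

/-- A leaf-special point is near-special (g10, tree). [folklore] -/
theorem isNearSpecialPt_of_isLeafSpecialPt {k : Type} [Field k] {Y : Scheme.{0}} {g : Y ⟶ Spec (.of k)}
    {hY : Scheme.IsRegular Y} {I : Y.IdealSheafData} {n : ℕ} {y : Y} (h : IsLeafSpecialPt g hY I n y) :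
    VeryNearCutClasses.IsNearSpecialPt g hY I n y :=
  h.1.1

/-- A leaf-special point is face-special (g9, tree). [folklore] -/
theorem isFaceSpecialPt_of_isLeafSpecialPt {k : Type} [Field k] {Y : Scheme.{0}} {g : Y ⟶ Spec (.of k)}
    {hY : Scheme.IsRegular Y} {I : Y.IdealSheafData} {n : ℕ} {y : Y} (h : IsLeafSpecialPt g hY I n y) :
    FaceFormCutClasses.IsFaceSpecialPt g hY I n y :=
  VeryNearCutKernels.isFaceSpecialPt_of_isNearSpecialPt h.1.1

/-- A leaf-special point is δ-special (g11, tree). [folklore] -/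
theorem isDeltaSpecialPt_of_isLeafSpecialPt {k : Type} [Field k] {Y : Scheme.{0}} {g : Y ⟶ Spec (.of k)}
    {hY : Scheme.IsRegular Y} {I : Y.IdealSheafData} {n : ℕ} {y : Y} (h : IsLeafSpecialPt g hY I n y) :
    IsDeltaSpecialPt g hY I n y :=
  ⟨isFaceSpecialPt_of_isLeafSpecialPt h, h.1.2.1⟩

/-- **EXACT at each marking**: `SeqDimFour 1 n ⟺ SeqLGen n ∧ SeqLSpec n` (excluded middle on «some top point is
leaf-special»). [folklore] -/
theorem seqDimFour_one_iff : SeqDimFour 1 n ↔ SeqLGen n ∧ SeqLSpec n := by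
  constructor
  · intro h
    refine ⟨?_, ?_⟩
    · intro p hp k _ _ Y g h1 h2 h3 hY h4 I hord _
      exact h p hp k Y g h1 h2 h3 hY h4 I hord (fun y _ => Or.inl le_rfl)
    · intro p hp k _ _ Y g h1 h2 h3 hY h4 I hord _
      exact h p hp k Y g h1 h2 h3 hY h4 I hord (fun y _ => Or.inl le_rfl)
  · rintro ⟨hG, hS⟩ p hp k _ _ Y g h1 h2 h3 hY h4 I hord _
    by_cases hex : ∃ y : Y, idealOrder I y = ((n : ℕ) : ℕ∞) ∧ IsLeafSpecialPt g hY I n y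
    · exact hS p hp k Y g h1 h2 h3 hY h4 I hord hex
    · refine hG p hp k Y g h1 h2 h3 hY h4 I hord ?_
      intro y hy
      rcases classGE_or_gen_or_lspecial g hY I n y with h | h
      · exact h
      · exact absurd ⟨y, hy, h⟩ hex

/-- The two classes at one marking give all data. [folklore] -/
theorem seqDimFour_one_of_lgen_lspec (hG : SeqLGen n) (hS : SeqLSpec n) : SeqDimFour 1 n :=
  seqDimFour_one_iff.mpr ⟨hG, hS⟩

/-- `SeqLGen n` is `SeqDimFour 1 n` restricted: weaker BY LETTER. [folklore] -/
theorem seqLGen_of_seqDimFour_one (h : SeqDimFour 1 n) : SeqLGen n := (seqDimFour_one_iff.mp h).1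

/-- `SeqLSpec n` is `SeqDimFour 1 n` restricted: weaker BY LETTER. [folklore] -/
theorem seqLSpec_of_seqDimFour_one (h : SeqDimFour 1 n) : SeqLSpec n := (seqDimFour_one_iff.mp h).2

/-- `SeqDimFour 2 n` is `SeqLGen n` restricted. [folklore] -/
theorem seqDimFour_two_of_seqLGen (h : SeqLGen n) : SeqDimFour 2 n := by
  intro p hp k _ _ Y g h1 h2 h3 hY h4 I hord hcls
  exact h p hp k Y g h1 h2 h3 hY h4 I hord (fun y hy => Or.inl (hcls y hy))

/-- g12's decided schema `SeqRGen n` (restated) is `SeqLGen n` restricted (the two new classes ENLARGE the decided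
class). [folklore] -/
theorem seqRGen_of_seqLGen (h : SeqLGen n) : SeqRGen n := by
  intro p hp k _ _ Y g h1 h2 h3 hY h4 I hord hcls
  refine h p hp k Y g h1 h2 h3 hY h4 I hord ?_
  intro y hy
  rcases hcls y hy with h' | h' | h' | h'
  · exact Or.inl h'
  · exact Or.inr (Or.inl h')
  · exact Or.inr (Or.inr (Or.inl h'))
  · exact Or.inr (Or.inr (Or.inr (Or.inl h')))

/-- g10's decided schema `SeqNGen n` (tree) is `SeqLGen n` restricted. [folklore] -/
theorem seqNGen_of_seqLGen (h : SeqLGen n) : VeryNearCutClasses.SeqNGen n := by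
  intro p hp k _ _ Y g h1 h2 h3 hY h4 I hord hcls
  refine h p hp k Y g h1 h2 h3 hY h4 I hord ?_
  intro y hy
  rcases hcls y hy with h' | h'
  · exact Or.inl h'
  · exact Or.inr (Or.inl h')

/-- g11's decided schema `SeqDGen n` (tree) is `SeqLGen n` restricted (face-generic ⇒ near-generic, tree kernel
`VeryNearCutKernels.isNearGenericPt_of_isFaceGenericPt`). [folklore] -/
theorem seqDGen_of_seqLGen (h : SeqLGen n) : SeqDGen n := by
  intro p hp k _ _ Y g h1 h2 h3 hY h4 I hord hcls
  refine h p hp k Y g h1 h2 h3 hY h4 I hord ?_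
  intro y hy
  rcases hcls y hy with (h' | h') | h'
  · exact Or.inl h'
  · exact Or.inr (Or.inl (VeryNearCutKernels.isNearGenericPt_of_isFaceGenericPt h'))
  · exact Or.inr (Or.inr (Or.inl h'))

/-- g12's located schema `SeqRSpec n` (restated) gives `SeqLSpec n` (leaf-special ⇒ relatively special): the located
class SHRINKS by letter. [folklore] -/
theorem seqLSpec_of_seqRSpec (h : SeqRSpec n) : SeqLSpec n := by
  intro p hp k _ _ Y g h1 h2 h3 hY h4 I hord hex
  obtain ⟨y, hy, hs⟩ := hex
  exact h p hp k Y g h1 h2 h3 hY h4 I hord ⟨y, hy, hs.1⟩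

/-- g10's located schema `SeqNSpec n` (tree) gives `SeqLSpec n`. [folklore] -/
theorem seqLSpec_of_seqNSpec (h : VeryNearCutClasses.SeqNSpec n) : SeqLSpec n := by
  intro p hp k _ _ Y g h1 h2 h3 hY h4 I hord hex
  obtain ⟨y, hy, hs⟩ := hex
  exact h p hp k Y g h1 h2 h3 hY h4 I hord ⟨y, hy, hs.1.1⟩

/-- g11's located schema `SeqDSpec n` (tree) gives `SeqLSpec n`. [folklore] -/
theorem seqLSpec_of_seqDSpec (h : SeqDSpec n) : SeqLSpec n := by
  intro p hp k _ _ Y g h1 h2 h3 hY h4 I hord hex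
  obtain ⟨y, hy, hs⟩ := hex
  exact h p hp k Y g h1 h2 h3 hY h4 I hord ⟨y, hy, isDeltaSpecialPt_of_isLeafSpecialPt hs⟩

/-- g12's NON-ISOLATED column gives this node's (the column SHRINKS by letter). [folklore] -/
theorem seqLSpecNonIso_of_seqRSpecNonIso (h : SeqRSpecNonIso n) : SeqLSpecNonIso n := by
  intro p hp k _ _ Y g h1 h2 h3 hY h4 I hord hex
  obtain ⟨y, hy, hs, hni⟩ := hex
  exact h p hp k Y g h1 h2 h3 hY h4 I hord ⟨y, hy, hs.1, hni⟩

/-- g11's NON-ISOLATED column (tree) gives this node's. [folklore] -/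
theorem seqLSpecNonIso_of_seqDSpecNonIso (h : SeqDSpecNonIso n) : SeqLSpecNonIso n := by
  intro p hp k _ _ Y g h1 h2 h3 hY h4 I hord hex
  obtain ⟨y, hy, hs, hni⟩ := hex
  exact h p hp k Y g h1 h2 h3 hY h4 I hord ⟨y, hy, isDeltaSpecialPt_of_isLeafSpecialPt hs, hni⟩

/-- **g12's CURVE stratum gives this node's** — THE STRATUM THIS NODE CUTS SHRINKS BY LETTER (the rel-curve-generic and
flat-curve points leave it). [folklore] -/
theorem seqLSpecCurve_of_seqRSpecCurve (h : SeqRSpecCurve n) : SeqLSpecCurve n := by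
  intro p hp k _ _ Y g h1 h2 h3 hY h4 I hord hex
  obtain ⟨y, hy, hs, hni, hcl⟩ := hex
  exact h p hp k Y g h1 h2 h3 hY h4 I hord ⟨y, hy, hs.1, hni, hcl⟩

/-- **EXACT isolation sub-cut of the located class**: `SeqLSpec n ⟺ SeqLSpecNonIso n ∧ SeqLSpecIso n`. [folklore] -/
theorem seqLSpec_iff_iso : SeqLSpec n ↔ SeqLSpecNonIso n ∧ SeqLSpecIso n := by
  constructor
  · intro h
    refine ⟨?_, ?_⟩
    · intro p hp k _ _ Y g h1 h2 h3 hY h4 I hord hex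
      obtain ⟨y, hy, hs, -⟩ := hex
      exact h p hp k Y g h1 h2 h3 hY h4 I hord ⟨y, hy, hs⟩
    · intro p hp k _ _ Y g h1 h2 h3 hY h4 I hord hex _
      exact h p hp k Y g h1 h2 h3 hY h4 I hord hex
  · rintro ⟨hN, hI⟩ p hp k _ _ Y g h1 h2 h3 hY h4 I hord hex
    by_cases hni : ∃ y : Y, idealOrder I y = ((n : ℕ) : ℕ∞) ∧ IsLeafSpecialPt g hY I n y ∧
        ¬ FaceFormCutClasses.IsIsolatedTop I n y
    · exact hN p hp k Y g h1 h2 h3 hY h4 I hord hni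
    · refine hI p hp k Y g h1 h2 h3 hY h4 I hord hex ?_
      intro y hy hs
      by_contra hiso
      exact hni ⟨y, hy, hs, hiso⟩

/-- The two isolation columns give the located class (`mpr`, by name for probes). [folklore] -/
theorem seqLSpec_of_iso (hN : SeqLSpecNonIso n) (hI : SeqLSpecIso n) : SeqLSpec n :=
  seqLSpec_iff_iso.mpr ⟨hN, hI⟩

/-- **EXACT sub-cut of the NON-ISOLATED column**: `SeqLSpecNonIso n ⟺ SeqLSpecCurve n ∧ SeqLSpecTangle n` (excluded
middle on «some non-isolated leaf-special top point lies on a clean curve»). [folklore] -/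
theorem seqLSpecNonIso_iff : SeqLSpecNonIso n ↔ SeqLSpecCurve n ∧ SeqLSpecTangle n := by
  constructor
  · intro h
    refine ⟨?_, ?_⟩
    · intro p hp k _ _ Y g h1 h2 h3 hY h4 I hord hex
      obtain ⟨y, hy, hs, hni, -⟩ := hex
      exact h p hp k Y g h1 h2 h3 hY h4 I hord ⟨y, hy, hs, hni⟩
    · intro p hp k _ _ Y g h1 h2 h3 hY h4 I hord hex _
      exact h p hp k Y g h1 h2 h3 hY h4 I hord hex
  · rintro ⟨hC, hT⟩ p hp k _ _ Y g h1 h2 h3 hY h4 I hord hex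
    by_cases hcur : ∃ y : Y, idealOrder I y = ((n : ℕ) : ℕ∞) ∧ IsLeafSpecialPt g hY I n y ∧
        ¬ FaceFormCutClasses.IsIsolatedTop I n y ∧ OnCleanCurve I n y
    · exact hC p hp k Y g h1 h2 h3 hY h4 I hord hcur
    · refine hT p hp k Y g h1 h2 h3 hY h4 I hord hex ?_
      intro y hy hs hni hcl
      exact hcur ⟨y, hy, hs, hni, hcl⟩

/-- The two strata give the non-isolated column (`mpr`, by name for probes). [folklore] -/
theorem seqLSpecNonIso_of_strata (hC : SeqLSpecCurve n) (hT : SeqLSpecTangle n) : SeqLSpecNonIso n :=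
  seqLSpecNonIso_iff.mpr ⟨hC, hT⟩

/-- The located class from its three leaves: CURVE, TANGLE, ISO. [folklore] -/
theorem seqLSpec_of_leaves (hC : SeqLSpecCurve n) (hT : SeqLSpecTangle n) (hI : SeqLSpecIso n) : SeqLSpec n :=
  seqLSpec_of_iso (seqLSpecNonIso_of_strata hC hT) hI




/-- ENGINE AT A POINT (iv): the NEW engine (A) `RelCurvePackageExit` makes a rel-curve-generic point a curve-exit point
OF g12's PORT (same conclusion shape `PackageExitsOver`). [folklore] -/
theorem isCurveExitPt_of_isRelCurveGenericPt {Y : Scheme.{0}} {I : Y.IdealSheafData} {n : ℕ} {y : Y}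
    (hR : RelCurvePackageExit) (hY : Scheme.IsRegular Y) (hn : 2 ≤ n) (h : IsRelCurveGenericPt I n y) :
    IsCurveExitPt I n y := by
  obtain ⟨η, a, b, hηy, hiso, hcurve⟩ := h
  exact ⟨η, hηy, hcurve.1, hiso, hR Y hY I n hn η a b hcurve⟩

/-- ENGINE AT A POINT (v): the NEW engine (B) `NormalConeJumpExit` makes a flat-curve point a curve-exit point of g12's
PORT. [folklore] -/
theorem isCurveExitPt_of_isFlatCurvePt {Y : Scheme.{0}} {I : Y.IdealSheafData} {n : ℕ} {y : Y}
    (hN : NormalConeJumpExit) (hY : Scheme.IsRegular Y) (hn : 2 ≤ n) (h : IsFlatCurvePt I n y) :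
    IsCurveExitPt I n y := by
  obtain ⟨η, hηy, hiso, hcurve⟩ := h
  exact ⟨η, hηy, hcurve.1, hiso, hN Y hY I n hn η hcurve⟩

/-- **THE ENGINES AT WORK (pure logic given the typed pieces)**: the tree engines `VeryNearExit` (g10) and
`DeltaPackageExit` (g11), g12's `UniformCurvePackageExit`, the NEW engines `RelCurvePackageExit` (A) and
`NormalConeJumpExit` (B), and g12's engine-free port `CurvePackagePort n` UNCHANGED give `LGenRungAt n` for `n ≥ 2`.
[folklore] -/
theorem lGenRungAt_of_engines (hV : VeryNearCutClasses.VeryNearExit) (hD : DeltaPackageExit)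
    (hU : UniformCurvePackageExit) (hR : RelCurvePackageExit) (hN : NormalConeJumpExit)
    (hP : CurvePackagePort n) (hn : 2 ≤ n) : LGenRungAt n := by
  intro h2 p hp k _ _ Y g hg1 hg2 hg3 hY h4 I hord hcls
  refine hP h2 p hp k Y g hg1 hg2 hg3 hY h4 I hord ?_
  intro y hy
  rcases hcls y hy with h | h | h | h | h | h
  · exact Or.inl h
  · exact Or.inr (Or.inl (isNearExitPt_of_isNearGenericPt hV hY hn h))
  · exact Or.inr (Or.inr (Or.inl (isPackageExitPt_of_isDeltaGenericPt hD hY hn hy h)))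
  · exact Or.inr (Or.inr (Or.inr (isCurveExitPt_of_isCurveGenericPt hU hY hn h)))
  · exact Or.inr (Or.inr (Or.inr (isCurveExitPt_of_isRelCurveGenericPt hR hY hn h)))
  · exact Or.inr (Or.inr (Or.inr (isCurveExitPt_of_isFlatCurvePt hN hY hn h)))

/-- At marking `1` every top point is a contact point (tree port `OrderOneContact`), hence of class ≥ 2: `LGenRungAt 1`
with no blow-up at all. [folklore] -/
theorem lGenRungAt_one (h1 : FaceFormCutClasses.OrderOneContact) : LGenRungAt 1 := by
  intro h2 p hp k _ _ Y g hg1 hg2 hg3 hY h4 I hord _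
  refine h2 p hp k Y g hg1 hg2 hg3 hY h4 I hord ?_
  intro y hy
  exact Or.inr (Or.inl (h1 p hp k Y g hg1 hg2 hg3 hY I y hy))

/-- **`LeafGenericRung` is DECIDED modulo the typed pieces**: five engines, g12's curve port at every marking `≥ 2`, and
the order-one contact port. [folklore] -/
theorem leafGenericRung_of_engines (hV : VeryNearCutClasses.VeryNearExit) (hD : DeltaPackageExit)
    (hU : UniformCurvePackageExit) (hR : RelCurvePackageExit) (hN : NormalConeJumpExit)
    (hP : ∀ n : ℕ, 2 ≤ n → CurvePackagePort n) (h1 : FaceFormCutClasses.OrderOneContact) : LeafGenericRung := by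
  intro hE2 n hn
  by_cases h : 2 ≤ n
  · exact lGenRungAt_of_engines hV hD hU hR hN (hP n h) h (hE2 n hn)
  · have hn1 : n = 1 := by omega
    subst hn1
    exact lGenRungAt_one h1 (hE2 1 hn)


end Kernels

end Summit.ResolutionOfSingularities.ResolutionOfSingularities.Theorems.CurveLeafExit
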